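import Summits.QuantumFields.BalabanUV.T4Continuum.Spine.NE3.PairLandauB8Avg
import Summits.QuantumFields.BalabanUV.T4Continuum.Support.NE3CornerGaugePoincare
import Summits.QuantumFields.BalabanUV.T4Continuum.Support.NE3FrameFreeDecompositionLinear
import Summits.QuantumFields.BalabanUV.T4Continuum.Support.NE3SmoothLiftW
import Summits.QuantumFields.BalabanUV.T4Continuum.Support.NE3CovariantSBound
import HarnessLib

/-!
# T⁴ programme, node NE3 — REPAIR R24 (γ3): THE LANDAU PROJECTION ONTO B8's GAUGE (1.38) — EXISTENCE of the correction `λ ∈ N(Q′(W))` making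
# `Y + gaugeDir W λ` Landau relative to `W`, and its k-FREE ℓ²-LETTER `Σ‖gaugeDir W λ‖²_HS ≤ 4·(L^k)²·Σ‖covDiv_W Y‖²_HS`

Cell `pub-balaban-gaps` (YM blitz, track G2, seat `ne3`, unit `pub-balaban-gaps-ne3`; writer prover-pub-balaban-gaps-ne3-g3-0, 2026-08-22), census
`run/shared/lean/pub/pub-balaban-gaps/ne/NE3.md` §4 R24 (γ).  THE PROBLEM.  The chart supplier on B8's surface needs a normal part `Nn` with `QbarIter L k W Nn = φ`
AND `IsLandauB8 L N k W Nn` ((1.38), so that the tangent datum `X = Nn − Z` lies in `slicB8`).  A right inverse of `QbarIter` (γ1) gives `Y` with the first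
property; THIS FILE supplies the second: a generator `λ` in B8's restricted gauge algebra `N(Q′(W)) = avgKernelGauges L N k W` (`bmeanIterW λ = 0`, so that
`QbarIter (gaugeDir W λ) = 0` by `NE3LandauOrbit.QbarIter_gaugeDir` + the curved (‡) — not used here) such that `Y + gaugeDir W λ` is (1.38)-Landau, together
with the ℓ²-size of the correction.  Inputs BY NAME (all landed): `Spine/NE3/PairLandauB8` (p340877 ✓: `avgKernelGauges`, `covLapSite`, `IsLandauB8`),
`NE3LandauOrbit.sum_hsR_gaugeDir` (Landau orthogonality = summation by parts on the torus), `NE3CornerGaugePoincare.sum_nhsNormSq_le_four_mul_of_bmeanIterW_eq_zero`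
(K6-Ξ: the k-FREE Poincaré inequality `Σ‖ξ‖² ≤ 4M²Σ‖gaugeDir W ξ‖²` on `bmeanIterW ξ = 0`), `NE3CovariantBlockMean.framePotW_gaugeDir` (‡),
`NE3CurvedCornerGaugeSpace.eq_zero_of_gaugeDir_eq_zero`, `NE3CovariantSBound.abs_hsR_le_nhsNorm`, and the Riesz-vector pattern of
`NE3FrameFreeSliceW.exists_orthogonalW_of_le` (`LinearMap.BilinForm.toDual` on a finite-dimensional real space).

CONTENT (0 sorry, no `def` — the submodule `N(Q′(W))` and the bilinear form are built inside the proofs):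
§1 `covDiv_gaugeDir_eq_covLapSite` — the tree's covariant site Laplacian `covLapSite W λ = Σ_ν D*_ν D_ν λ` IS `covDiv W (gaugeDir W λ)` (pointwise algebra);
   `covLapSite_add` ∕ `covLapSite_smul`; `covLapSite_add_period`; `hsR_le_weighted` (the weighted Cauchy–Schwarz `hsR X Y ≤ (t∕2)‖X‖²_HS + (1∕2t)‖Y‖²_HS`);
§2 `sum_hsR_gaugeDir_gaugeDir_covLapSite` — `Σ_{x,κ} hsR (gaugeDir W λ)(gaugeDir W (Δ_W ν)) = Σ_x hsR (Δ_W λ)(Δ_W ν)` (the Gram form of (1.38)'s test directions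
   is the Gram form of `Δ_W`: symmetric, positive semidefinite); `eq_zero_of_covLapSite_eq_zero` — on `N(Q′(W))` the covariant Laplacian is INJECTIVE
   (`Δλ = 0 ⇒ ⟨λ, Δλ⟩ = ‖D_Wλ‖² = 0 ⇒ D_Wλ = 0 ⇒ λ` corner-trivial by (‡) and `bmeanIterW λ = 0` `⇒ λ = 0`);
§3 **`exists_landauB8_correction`** — for every direction `Y` there is `λ ∈ avgKernelGauges L N (j+1) W` with `IsLandauB8 L N (j+1) W (Y + gaugeDir W λ)`
   (the Riesz vector of `ν ↦ −Σ hsR Y (gaugeDir W (Δ_W ν))` for the nondegenerate Gram form of §2 on the finite-dimensional real space `N(Q′(W))`);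
§4 **`sum_nhsNormSq_gaugeDir_le_of_isLandauB8`** — THE ℓ²-LETTER: for periodic `Y` and ANY `λ ∈ N(Q′(W))` with `Y + gaugeDir W λ` Landau,
   `Σ_{x,κ} nhsNormSq (gaugeDir W λ x κ) ≤ 4·(L^{j+1})²·Σ_x nhsNormSq (covDiv W Y x)` under K6-Ξ's displayed k-free smallness line
   (`‖Δλ‖² = −⟨covDiv Y, Δλ⟩ ≤ ‖covDiv Y‖‖Δλ‖`; `‖D_Wλ‖² = ⟨Δλ, λ⟩ ≤ ‖Δλ‖·2M‖D_Wλ‖`).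

WHAT THIS DOES NOT GIVE (honest; census R24 (γ3)): the SUP letter of the correction (`sup‖gaugeDir W λ‖`, the chart's (J1) currency for the normal part) —
an ℓ^∞ bound for this global elliptic solve is a [Balaban1985BackgroundPropagators] (3.47)-TYPE Green's-function decay input, NOT kinematics; and the
divergence letter `Σ‖covDiv_W Y‖² ≲ (L^k)^{d−4}·Σ‖φ‖²` of the right inverse (γ1).

HONEST FRAMING.  Finite-dimensional linear algebra and summation by parts on OUR typed objects at a background of the multi-level small-field class; nothing
about Bałaban's minimisers is asserted; the chart supplier, (P♮), (RES♯), the covariant root and **NE3 are NOT proved**; spine PROVED 0∕9; finite T⁴ rung (B)+1 —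
NOT infinite volume, NOT mass gap, NOT `BetaPertH`, NOT Clay.  ABSOLUTE RULE kept (context only: [Balaban1985RegularSpaces] (1.27) p. 80, (1.38) p. 82;
[Balaban1985BackgroundPropagators] (3.23), (3.46)–(3.47)).  PLACEMENT: `Summits/QuantumFields/BalabanUV/T4Continuum/Spine/NE3/`; imports accepted modules only;
moves nothing.  HONEST DEPENDENCY: continuum YM on T⁴ ⇐ BetaPertH ∧ nine spine estimates (0/9 proved); BetaPertH ⇐ (D1) ∧ (D4) ∧ CAP+tail; G-an2-4 gates asym,
D1 and NE2/3/4.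
-/

set_option autoImplicit false

open scoped BigOperators Matrix Matrix.Norms.L2Operator
open NormedSpace Finset

namespace Summit.QuantumFields.BalabanUV.T4Continuum.NE3.LandauProjectionB8

open Literature.MathematicalPhysics.QuantumFieldTheory.Balaban1983to89
open B7Prop1Explicit B7Prop2Explicit MatrixNorms
open T4AveragingDeficitWall (Ad IsUnitaryCfg IsSkewDir SmallField)
open T4AveragingDeficitWallBoundary (IsPeriodicCfg periodBox mem_periodBox)
open T4AveragingDeficitNonAbelian (Ad_sub)
open AveragingDeficitPeriodicCounting (IsPeriodicDir)
open AveragingDeficitNearIdentity (Ad_add Ad_real_smul)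
open AveragingDeficitTwoLevelPrep (prop1Radius)
open AveragingDeficitMultiLevelPrep (LevelSmall tower)
open BlockAveragePushDirGauge (gaugeDir isPeriodicDir_gaugeDir)
open NE3CovariantCalculus (hsR hsR_self hsR_comm hsR_add_left hsR_add_right cD cDstar)
open NE3CovariantWeitzenbock (covDiv)
open NE3LandauOrbit (eq_zero_of_nhsNormSq_eq_zero sum_hsR_gaugeDir covDiv_add_period hsR_neg_right)
open NE3FrameFreeDecompositionPrep (hsR_smul_left hsR_smul_right)
open NE3CurvedCornerGaugeSpace (gaugeDir_add_pi gaugeDir_smul_pi eq_zero_of_gaugeDir_eq_zero)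
open NE3CovariantBlockPoincare (Ad_inv_Ad)
open NE3GaugeDirFrames (Ad_Ad_inv)
open NE3CovariantBlockMean (bmeanIterW framePotW_gaugeDir)
open NE3FrameFreeSliceW (bmeanIterW_add bmeanIterW_smul bmeanIterW_zero')
open NE3FrameFreeDecompositionLinear (framePotW_zero_dir)
open NE3SmoothLiftW (tower_eq_pow_mul)
open NE3CovariantSBound (abs_hsR_le_nhsNorm)
open NE3CornerGaugePoincare (sum_nhsNormSq_le_four_mul_of_bmeanIterW_eq_zero)
open PeriodicChoice (apply_wrap_eq wrap_mem_periodBox)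
open SpreadLift (loopRad)
open NE3.PairLandauB8 (avgKernelGauges mem_avgKernelGauges_iff covLapSite IsLandauB8)

noncomputable section

variable {d : ℕ} {n : Type*} [Fintype n] [DecidableEq n]

/-! ## §1 The covariant site Laplacian is `covDiv ∘ gaugeDir`; linearity; a weighted Cauchy–Schwarz -/

/-- **`Δ_W = covDiv_W ∘ D_W`**: the tree's covariant site Laplacian `covLapSite W λ = Σ_ν cDstar W ν (cD W ν λ)` ([Balaban1985BackgroundPropagators] (3.23) TYPE)
coincides with the covariant divergence of the linearised gauge direction `gaugeDir W λ` — both equal `Σ_ν (2λ(x) − Ad_{W(x,ν)} λ(x+e_ν) − Ad_{W(x−e_ν,ν)}⁻¹ λ(x−e_ν))`.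
[folklore] -/
theorem covDiv_gaugeDir_eq_covLapSite (W : Site d → Fin d → (Matrix n n ℂ)ˣ) (lam : Site d → Matrix n n ℂ) :
    covDiv W (gaugeDir W lam) = covLapSite W lam := by
  funext x
  unfold covDiv covLapSite cDstar cD gaugeDir
  refine Finset.sum_congr rfl fun ν _ => ?_
  simp only [sub_add_cancel, Ad_sub, Ad_Ad_inv, Ad_inv_Ad]
  abel

/-- `covLapSite` is additive in the generator. [folklore] -/
theorem covLapSite_add (W : Site d → Fin d → (Matrix n n ℂ)ˣ) (lam mu : Site d → Matrix n n ℂ) :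
    covLapSite W (lam + mu) = covLapSite W lam + covLapSite W mu := by
  rw [← covDiv_gaugeDir_eq_covLapSite, ← covDiv_gaugeDir_eq_covLapSite, ← covDiv_gaugeDir_eq_covLapSite]
  funext x
  have h : gaugeDir W (lam + mu) = gaugeDir W lam + gaugeDir W mu := by
    funext y κ; exact gaugeDir_add_pi W lam mu y κ
  rw [h, Pi.add_apply]
  unfold covDiv
  rw [← Finset.sum_add_distrib]
  exact Finset.sum_congr rfl fun κ _ => by simp only [Pi.add_apply, Ad_add]; abel

/-- `covLapSite` is real-homogeneous in the generator. [folklore] -/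
theorem covLapSite_smul (W : Site d → Fin d → (Matrix n n ℂ)ˣ) (t : ℝ) (lam : Site d → Matrix n n ℂ) :
    covLapSite W (t • lam) = t • covLapSite W lam := by
  rw [← covDiv_gaugeDir_eq_covLapSite, ← covDiv_gaugeDir_eq_covLapSite]
  funext x
  have h : gaugeDir W (t • lam) = t • gaugeDir W lam := by
    funext y κ; exact gaugeDir_smul_pi W t lam y κ
  rw [h, Pi.smul_apply]
  unfold covDiv
  rw [Finset.smul_sum]
  exact Finset.sum_congr rfl fun κ _ => by simp only [Pi.smul_apply, Ad_real_smul, smul_sub]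

/-- The covariant Laplacian of a periodic generator at a periodic background is periodic. [folklore] -/
theorem covLapSite_add_period {P : ℕ} {W : Site d → Fin d → (Matrix n n ℂ)ˣ} (hWP : IsPeriodicCfg W (P : ℤ)) {lam : Site d → Matrix n n ℂ}
    (hlam : ∀ (x : Site d) (i : Fin d), lam (x + (P : ℤ) • e i) = lam x) (x : Site d) (τ : Fin d) :
    covLapSite W lam (x + (P : ℤ) • e τ) = covLapSite W lam x := by
  rw [← covDiv_gaugeDir_eq_covLapSite]
  exact covDiv_add_period hWP (isPeriodicDir_gaugeDir hWP hlam) x τ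

omit [DecidableEq n] in
/-- **WEIGHTED CAUCHY–SCHWARZ IN HS CURRENCY**: `hsR X Y ≤ (t∕2)·nhsNormSq X + (1∕(2t))·nhsNormSq Y` for `t > 0`. [folklore] -/
theorem hsR_le_weighted (X Y : Matrix n n ℂ) {t : ℝ} (ht : 0 < t) :
    hsR X Y ≤ t / 2 * nhsNormSq X + 1 / (2 * t) * nhsNormSq Y := by
  have h1 : hsR X Y ≤ nhsNorm X * nhsNorm Y := (le_abs_self _).trans (abs_hsR_le_nhsNorm X Y)
  have ha : nhsNorm X ^ 2 = nhsNormSq X := Real.sq_sqrt (nhsNormSq_nonneg X)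
  have hb : nhsNorm Y ^ 2 = nhsNormSq Y := Real.sq_sqrt (nhsNormSq_nonneg Y)
  have h2t : 0 < 2 * t := by positivity
  have key : nhsNorm X * nhsNorm Y * (2 * t) ≤ (t / 2 * nhsNormSq X + 1 / (2 * t) * nhsNormSq Y) * (2 * t) := by
    have h1 : t / 2 * nhsNormSq X * (2 * t) = t ^ 2 * nhsNorm X ^ 2 := by rw [ha]; ring
    have h2 : 1 / (2 * t) * nhsNormSq Y * (2 * t) = nhsNorm Y ^ 2 := by
      rw [hb, mul_comm, ← mul_assoc, mul_one_div_cancel h2t.ne', one_mul]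
    rw [add_mul, h1, h2]
    nlinarith [sq_nonneg (t * nhsNorm X - nhsNorm Y)]
  exact h1.trans (le_of_mul_le_mul_right key h2t)

/-! ## §2 The Gram form of (1.38)'s test directions is the Gram form of `Δ_W`; injectivity of `Δ_W` on `N(Q′(W))` -/

/-- **`Σ_{x,κ} hsR (gaugeDir W λ)(gaugeDir W (Δ_W ν)) = Σ_x hsR (Δ_W λ)(Δ_W ν)`** over one period (unitary periodic `W`, periodic `λ, ν`): Landau orthogonality
(`sum_hsR_gaugeDir`) followed by §1's identity. [folklore] -/
theorem sum_hsR_gaugeDir_gaugeDir_covLapSite {P : ℕ} (hP : 1 ≤ P) {W : Site d → Fin d → (Matrix n n ℂ)ˣ} (hWu : IsUnitaryCfg W)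
    (hWP : IsPeriodicCfg W (P : ℤ)) {lam nu : Site d → Matrix n n ℂ} (hlam : ∀ (x : Site d) (i : Fin d), lam (x + (P : ℤ) • e i) = lam x)
    (hnu : ∀ (x : Site d) (i : Fin d), nu (x + (P : ℤ) • e i) = nu x) :
    ∑ x ∈ periodBox (d := d) P, ∑ κ : Fin d, hsR (gaugeDir W lam x κ) (gaugeDir W (covLapSite W nu) x κ)
      = ∑ x ∈ periodBox (d := d) P, hsR (covLapSite W lam x) (covLapSite W nu x) := by
  rw [sum_hsR_gaugeDir hP hWu (isPeriodicDir_gaugeDir hWP hlam) (covLapSite_add_period hWP hnu), covDiv_gaugeDir_eq_covLapSite]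

/-- **`Σ_{x,κ} nhsNormSq (gaugeDir W λ x κ) = Σ_x hsR (Δ_W λ x) (λ x)`** over one period. [folklore] -/
theorem sum_nhsNormSq_gaugeDir_eq {P : ℕ} (hP : 1 ≤ P) {W : Site d → Fin d → (Matrix n n ℂ)ˣ} (hWu : IsUnitaryCfg W)
    (hWP : IsPeriodicCfg W (P : ℤ)) {lam : Site d → Matrix n n ℂ} (hlam : ∀ (x : Site d) (i : Fin d), lam (x + (P : ℤ) • e i) = lam x) :
    ∑ x ∈ periodBox (d := d) P, ∑ κ : Fin d, nhsNormSq (gaugeDir W lam x κ)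
      = ∑ x ∈ periodBox (d := d) P, hsR (covLapSite W lam x) (lam x) := by
  simp_rw [← hsR_self]
  rw [sum_hsR_gaugeDir hP hWu (isPeriodicDir_gaugeDir hWP hlam) hlam, covDiv_gaugeDir_eq_covLapSite]

/-- **`Δ_W` IS INJECTIVE ON `N(Q′(W))`** (multi-level small-field class at `W`, level `j+1`, period `N·L^{j+1}`): a generator `λ ∈ avgKernelGauges L N (j+1) W`
with `covLapSite W λ = 0` on the period box vanishes — `‖D_Wλ‖² = ⟨Δλ, λ⟩ = 0`, so `gaugeDir W λ = 0`; the curved (‡) `framePotW_gaugeDir` then reads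
`λ(L^{j+1}•z) = bmeanIterW λ z = 0`, and a corner-trivial generator with vanishing direction is zero (`eq_zero_of_gaugeDir_eq_zero`). [folklore] -/
theorem eq_zero_of_covLapSite_eq_zero [Nonempty n] {L N : ℕ} (hL : 1 ≤ L) (hN : 1 ≤ N) (j : ℕ) {W : Site d → Fin d → (Matrix n n ℂ)ˣ} {x : ℝ}
    (hWu : IsUnitaryCfg W) (hWP : IsPeriodicCfg W ((N * L ^ (j + 1) : ℕ) : ℤ)) (hx : 0 ≤ x) (hs : LevelSmall d L j x) (hWx : SmallField W x)
    {lam : Site d → Matrix n n ℂ} (hlam : lam ∈ avgKernelGauges (d := d) (n := n) L N (j + 1) W)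
    (h0 : ∀ y ∈ periodBox (d := d) (N * L ^ (j + 1)), covLapSite W lam y = 0) : lam = 0 := by
  haveI : NeZero N := ⟨by omega⟩
  obtain ⟨hls, hlP, hl0⟩ := mem_avgKernelGauges_iff.mp hlam
  have hP : 1 ≤ N * L ^ (j + 1) := Nat.mul_pos (by omega) (Nat.pow_pos (by omega))
  -- `‖D_W λ‖² = ⟨Δλ, λ⟩ = 0`
  have hG : ∑ y ∈ periodBox (d := d) (N * L ^ (j + 1)), ∑ κ : Fin d, nhsNormSq (gaugeDir W lam y κ) = 0 := by
    rw [sum_nhsNormSq_gaugeDir_eq hP hWu hWP hlP]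
    exact Finset.sum_eq_zero fun y hy => by rw [h0 y hy]; exact NE3LandauOrbit.hsR_zero_left _
  have hbox : ∀ y ∈ periodBox (d := d) (N * L ^ (j + 1)), ∀ κ : Fin d, gaugeDir W lam y κ = 0 := by
    intro y hy κ
    have h1 := (Finset.sum_eq_zero_iff_of_nonneg fun y' _ =>
      Finset.sum_nonneg fun ν _ => nhsNormSq_nonneg (gaugeDir W lam y' ν)).1 hG y hy
    have h2 := (Finset.sum_eq_zero_iff_of_nonneg fun ν _ => nhsNormSq_nonneg (gaugeDir W lam y ν)).1 h1 κ (Finset.mem_univ κ)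
    exact eq_zero_of_nhsNormSq_eq_zero h2
  have hper := isPeriodicDir_gaugeDir hWP hlP
  have hall : ∀ (y : Site d) (κ : Fin d), gaugeDir W lam y κ = 0 := by
    intro y κ
    have hw := apply_wrap_eq (g := fun y' => gaugeDir W lam y' κ) (fun y' i => hper y' i κ) y
    rw [← hw]
    exact hbox _ (wrap_mem_periodBox (N * L ^ (j + 1)) hP y) κ
  have hzero : gaugeDir W lam = fun _ _ => 0 := by funext y κ; exact hall y κ
  -- the curved (‡): `λ` is corner-trivial
  have hWPt : IsPeriodicCfg W ((tower L N (j + 1) : ℕ) : ℤ) := by rw [tower_eq_pow_mul, Nat.mul_comm]; exact hWP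
  have hlPt : ∀ (y : Site d) (i : Fin d), lam (y + ((tower L N (j + 1) : ℕ) : ℤ) • e i) = lam y := by
    rw [tower_eq_pow_mul, Nat.mul_comm]; exact hlP
  have hcorner : ∀ w : Site d, lam (((L ^ (j + 1) : ℕ) : ℤ) • w) = 0 := by
    intro w
    have h := framePotW_gaugeDir (M := N) hL j hWu hWPt hx hs hWx hls hlPt w
    rw [hzero, framePotW_zero_dir hL j hWu hx hs hWx w, hl0] at h
    have h' : lam (((L : ℤ) ^ (j + 1)) • w) = 0 := by
      have := h.symm
      simpa using this
    push_cast
    exact h'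
  have hM : 1 ≤ L ^ (j + 1) := Nat.one_le_pow _ _ (by omega)
  exact eq_zero_of_gaugeDir_eq_zero hM hall hcorner

/-! ## §3 Existence of the Landau correction -/

/-- **THE LANDAU PROJECTION ONTO B8's GAUGE — EXISTENCE** (multi-level small-field class at `W`, level `j+1`, period `N·L^{j+1}`): for every direction
field `Y` there is a generator `λ ∈ N(Q′(W))` (`avgKernelGauges L N (j+1) W`: skew, periodic, `bmeanIterW λ = 0`) such that `Y + gaugeDir W λ` is Landau relative
to `W` in the sense of [Balaban1985RegularSpaces] (1.38) (`IsLandauB8`).  The Riesz vector of `ν ↦ −Σ hsR Y (gaugeDir W (Δ_W ν))` for the Gram form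
`(λ, ν) ↦ Σ hsR (gaugeDir W λ)(gaugeDir W (Δ_W ν)) = Σ hsR (Δλ)(Δν)` on the finite-dimensional real space `N(Q′(W))`, nondegenerate by §2. [folklore] -/
theorem exists_landauB8_correction [Nonempty n] {L N : ℕ} (hL : 1 ≤ L) (hN : 1 ≤ N) (j : ℕ) {W : Site d → Fin d → (Matrix n n ℂ)ˣ} {x : ℝ}
    (hWu : IsUnitaryCfg W) (hWP : IsPeriodicCfg W ((N * L ^ (j + 1) : ℕ) : ℤ)) (hx : 0 ≤ x) (hs : LevelSmall d L j x) (hWx : SmallField W x)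
    (Y : Site d → Fin d → Matrix n n ℂ) :
    ∃ lam ∈ avgKernelGauges (d := d) (n := n) L N (j + 1) W,
      IsLandauB8 (d := d) L N (j + 1) W (fun y κ => Y y κ + gaugeDir W lam y κ) := by
  haveI : NeZero N := ⟨by omega⟩
  have hP : 1 ≤ N * L ^ (j + 1) := Nat.mul_pos (by omega) (Nat.pow_pos (by omega))
  -- `N(Q′(W))` as a real submodule
  let S : Submodule ℝ (Site d → Matrix n n ℂ) :=
    { carrier := avgKernelGauges (d := d) (n := n) L N (j + 1) W
      zero_mem' := ⟨fun _ => (skewAdjoint _).zero_mem, fun _ _ => rfl, bmeanIterW_zero' L (j + 1) W⟩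
      add_mem' := by
        rintro mu nu ⟨hμs, hμP, hμ0⟩ ⟨hνs, hνP, hν0⟩
        refine ⟨fun y => (skewAdjoint _).add_mem (hμs y) (hνs y), fun y i => ?_, ?_⟩
        · simp only [Pi.add_apply, hμP, hνP]
        · rw [bmeanIterW_add, hμ0, hν0, add_zero]
      smul_mem' := by
        rintro t mu ⟨hμs, hμP, hμ0⟩
        refine ⟨fun y => skewAdjoint.smul_mem t (hμs y), fun y i => ?_, ?_⟩
        · simp only [Pi.smul_apply, hμP]
        · rw [bmeanIterW_smul, hμ0, smul_zero] }
  have hSmem : ∀ {mu : Site d → Matrix n n ℂ}, mu ∈ S ↔ mu ∈ avgKernelGauges (d := d) (n := n) L N (j + 1) W := fun {mu} => Iff.rfl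
  -- finite-dimensional: restriction to the period box is injective
  haveI : FiniteDimensional ℝ S := by
    let res : S →ₗ[ℝ] (↥(periodBox (d := d) (N * L ^ (j + 1))) → Matrix n n ℂ) :=
      { toFun := fun ξ y => (ξ : Site d → Matrix n n ℂ) y.1
        map_add' := fun _ _ => rfl
        map_smul' := fun _ _ => rfl }
    refine FiniteDimensional.of_injective res fun ξ ζ h => ?_
    apply Subtype.ext
    funext y
    have hξ := apply_wrap_eq (mem_avgKernelGauges_iff.mp (hSmem.mp ξ.2)).2.1 y
    have hζ := apply_wrap_eq (mem_avgKernelGauges_iff.mp (hSmem.mp ζ.2)).2.1 y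
    rw [← hξ, ← hζ]
    exact congr_fun h ⟨_, wrap_mem_periodBox (N * L ^ (j + 1)) hP y⟩
  -- the Gram form of (1.38)'s test directions
  let G : LinearMap.BilinForm ℝ S :=
    LinearMap.mk₂ ℝ
      (fun lam nu => ∑ y ∈ periodBox (d := d) (N * L ^ (j + 1)), ∑ κ : Fin d,
        hsR (gaugeDir W (lam : Site d → Matrix n n ℂ) y κ) (gaugeDir W (covLapSite W (nu : Site d → Matrix n n ℂ)) y κ))
      (fun lam lam' nu => by
        simp only [Submodule.coe_add, gaugeDir_add_pi, hsR_add_left, Finset.sum_add_distrib])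
      (fun t lam nu => by
        simp only [Submodule.coe_smul, gaugeDir_smul_pi, hsR_smul_left, Finset.mul_sum, smul_eq_mul])
      (fun lam nu nu' => by
        simp only [Submodule.coe_add, covLapSite_add, gaugeDir_add_pi, hsR_add_right, Finset.sum_add_distrib])
      (fun t lam nu => by
        simp only [Submodule.coe_smul, covLapSite_smul, gaugeDir_smul_pi, hsR_smul_right, Finset.mul_sum, smul_eq_mul])
  have hG : ∀ lam nu : S, G lam nu = ∑ y ∈ periodBox (d := d) (N * L ^ (j + 1)), ∑ κ : Fin d,
      hsR (gaugeDir W (lam : Site d → Matrix n n ℂ) y κ) (gaugeDir W (covLapSite W (nu : Site d → Matrix n n ℂ)) y κ) := fun _ _ => rfl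
  -- nondegeneracy: `G λ λ = Σ‖Δλ‖²`
  have key : ∀ lam : S, G lam lam = 0 → lam = 0 := by
    intro lam h
    obtain ⟨hls, hlP, hl0⟩ := mem_avgKernelGauges_iff.mp (hSmem.mp lam.2)
    rw [hG, sum_hsR_gaugeDir_gaugeDir_covLapSite hP hWu hWP hlP hlP] at h
    simp only [hsR_self] at h
    have hbox : ∀ y ∈ periodBox (d := d) (N * L ^ (j + 1)), covLapSite W (lam : Site d → Matrix n n ℂ) y = 0 := by
      intro y hy
      have h1 := (Finset.sum_eq_zero_iff_of_nonneg fun y' _ => nhsNormSq_nonneg (covLapSite W (lam : Site d → Matrix n n ℂ) y')).1 h y hy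
      exact eq_zero_of_nhsNormSq_eq_zero h1
    exact Subtype.ext (eq_zero_of_covLapSite_eq_zero hL hN j hWu hWP hx hs hWx (hSmem.mp lam.2) hbox)
  have hGnd : G.Nondegenerate := ⟨fun lam hlam => key lam (hlam lam), fun lam hlam => key lam (hlam lam)⟩
  -- the functional and its Riesz vector
  let ℓ : Module.Dual ℝ S :=
    { toFun := fun nu => -∑ y ∈ periodBox (d := d) (N * L ^ (j + 1)), ∑ κ : Fin d,
        hsR (Y y κ) (gaugeDir W (covLapSite W (nu : Site d → Matrix n n ℂ)) y κ)
      map_add' := fun nu nu' => by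
        simp only [Submodule.coe_add, covLapSite_add, gaugeDir_add_pi, hsR_add_right, Finset.sum_add_distrib, neg_add]
      map_smul' := fun t nu => by
        simp only [Submodule.coe_smul, covLapSite_smul, gaugeDir_smul_pi, hsR_smul_right, Finset.mul_sum, RingHom.id_apply,
          smul_eq_mul, mul_neg] }
  set lam := (G.toDual hGnd).symm ℓ with hlam_def
  refine ⟨lam, hSmem.mp lam.2, fun nu hnu => ?_⟩
  have h := LinearMap.BilinForm.apply_toDual_symm_apply (hB := hGnd) ℓ ⟨nu, hnu⟩
  rw [← hlam_def, hG] at h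
  have hℓ : ℓ ⟨nu, hnu⟩ = -∑ y ∈ periodBox (d := d) (N * L ^ (j + 1)), ∑ κ : Fin d,
      hsR (Y y κ) (gaugeDir W (covLapSite W nu) y κ) := rfl
  rw [hℓ] at h
  simp only [hsR_add_left, Finset.sum_add_distrib]
  linarith

/-! ## §4 The ℓ²-letter of the Landau correction -/

/-- **THE ℓ²-LETTER OF THE LANDAU CORRECTION, k-FREE** (multi-level small-field class at `W`, level `j+1`, `M = L^{j+1}`, period `N·M`, `L ≥ 2`, and K6-Ξ's
displayed smallness line `8d((d−1)M(M−1)x)² + 2·card n·(4d²(M−1)²x + 16d·loopRad(d,L,r_j))² ≤ 1∕2` — k-free in the chart's class): for a periodic direction `Y`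
and ANY `λ ∈ N(Q′(W))` such that `Y + gaugeDir W λ` is (1.38)-Landau,
`Σ_{x,κ} nhsNormSq (gaugeDir W λ x κ) ≤ 4·M²·Σ_x nhsNormSq (covDiv W Y x)`.
MECHANISM: testing (1.38) against `ν = λ` gives `Σ‖Δλ‖² = −Σ hsR (covDiv Y)(Δλ)`, whence `Σ‖Δλ‖² ≤ Σ‖covDiv Y‖²`; and
`Σ‖D_Wλ‖² = Σ hsR (Δλ)(λ) ≤ (t∕2)Σ‖Δλ‖² + (1∕2t)Σ‖λ‖²` with K6-Ξ's Poincaré `Σ‖λ‖² ≤ 4M²Σ‖D_Wλ‖²` at `t = 4M²`.  So the correction costs `2M·‖covDiv_W Y‖₂`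
in ℓ² — k-free as soon as the right inverse's divergence is `O(‖Y‖₂∕M)` (census R24 (γ1)). [folklore] -/
theorem sum_nhsNormSq_gaugeDir_le_of_isLandauB8 [Nonempty n] {L N : ℕ} (hL : 2 ≤ L) (hN : 1 ≤ N) (j : ℕ) {W : Site d → Fin d → (Matrix n n ℂ)ˣ} {x : ℝ}
    (hWu : IsUnitaryCfg W) (hWP : IsPeriodicCfg W ((N * L ^ (j + 1) : ℕ) : ℤ)) (hx : 0 ≤ x) (hs : LevelSmall d L j x) (hWx : SmallField W x)
    (hPs : 8 * d * (((L : ℝ) ^ (j + 1)) * (((d : ℝ) - 1) * (((L : ℝ) ^ (j + 1)) - 1) * x)) ^ 2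
      + 2 * (Fintype.card n * (4 * (d : ℝ) ^ 2 * ((L : ℝ) ^ (j + 1) - 1) ^ 2 * x + 16 * d * loopRad d L ((prop1Radius d L)^[j] x)) ^ 2)
        ≤ 1 / 2)
    {Y : Site d → Fin d → Matrix n n ℂ} (hY : IsPeriodicDir Y ((N * L ^ (j + 1) : ℕ) : ℤ))
    {lam : Site d → Matrix n n ℂ} (hlam : lam ∈ avgKernelGauges (d := d) (n := n) L N (j + 1) W)
    (hLan : IsLandauB8 (d := d) L N (j + 1) W (fun y κ => Y y κ + gaugeDir W lam y κ)) :
    ∑ y ∈ periodBox (d := d) (N * L ^ (j + 1)), ∑ κ : Fin d, nhsNormSq (gaugeDir W lam y κ)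
      ≤ 4 * ((L : ℝ) ^ (j + 1)) ^ 2 * ∑ y ∈ periodBox (d := d) (N * L ^ (j + 1)), nhsNormSq (covDiv W Y y) := by
  haveI : NeZero N := ⟨by omega⟩
  obtain ⟨hls, hlP, hl0⟩ := mem_avgKernelGauges_iff.mp hlam
  have hP : 1 ≤ N * L ^ (j + 1) := Nat.mul_pos (by omega) (Nat.pow_pos (by omega))
  set M : ℝ := (L : ℝ) ^ (j + 1) with hMdef
  have hM1 : 1 ≤ M := one_le_pow₀ (by exact_mod_cast (show 1 ≤ L by omega))
  have hM0 : 0 < M := by linarith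
  -- the three quadratic quantities
  set Gl : ℝ := ∑ y ∈ periodBox (d := d) (N * L ^ (j + 1)), ∑ κ : Fin d, nhsNormSq (gaugeDir W lam y κ) with hGdef
  set D2 : ℝ := ∑ y ∈ periodBox (d := d) (N * L ^ (j + 1)), nhsNormSq (covLapSite W lam y) with hD2def
  set V : ℝ := ∑ y ∈ periodBox (d := d) (N * L ^ (j + 1)), nhsNormSq (covDiv W Y y) with hVdef
  set Λ2 : ℝ := ∑ y ∈ periodBox (d := d) (N * L ^ (j + 1)), nhsNormSq (lam y) with hΛ2def
  have hGl0 : 0 ≤ Gl := Finset.sum_nonneg fun _ _ => Finset.sum_nonneg fun _ _ => nhsNormSq_nonneg _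
  have hD20 : 0 ≤ D2 := Finset.sum_nonneg fun _ _ => nhsNormSq_nonneg _
  have hV0 : 0 ≤ V := Finset.sum_nonneg fun _ _ => nhsNormSq_nonneg _
  have hΔP : ∀ (y : Site d) (i : Fin d), covLapSite W lam (y + ((N * L ^ (j + 1) : ℕ) : ℤ) • e i) = covLapSite W lam y :=
    covLapSite_add_period hWP hlP
  -- (1) (1.38) tested against `ν = λ`: `Σ hsR Y (DΔλ) + Σ hsR (Dλ)(DΔλ) = 0`
  have h1 := hLan lam hlam
  simp only [hsR_add_left, Finset.sum_add_distrib] at h1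
  have hA : ∑ y ∈ periodBox (d := d) (N * L ^ (j + 1)), ∑ κ : Fin d, hsR (gaugeDir W lam y κ) (gaugeDir W (covLapSite W lam) y κ) = D2 := by
    rw [hD2def, sum_hsR_gaugeDir_gaugeDir_covLapSite hP hWu hWP hlP hlP]
    simp only [hsR_self]
  have hB : ∑ y ∈ periodBox (d := d) (N * L ^ (j + 1)), ∑ κ : Fin d, hsR (Y y κ) (gaugeDir W (covLapSite W lam) y κ)
      = ∑ y ∈ periodBox (d := d) (N * L ^ (j + 1)), hsR (covDiv W Y y) (covLapSite W lam y) := sum_hsR_gaugeDir hP hWu hY hΔP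
  rw [hA, hB] at h1
  -- (2) `D2 ≤ V`
  have hD2V : D2 ≤ V := by
    have hcs : ∑ y ∈ periodBox (d := d) (N * L ^ (j + 1)), hsR (covDiv W Y y) (-covLapSite W lam y) ≤ ∑ y ∈ periodBox (d := d) (N * L ^ (j + 1)), (1 / 2 * nhsNormSq (covDiv W Y y) + 1 / (2 * 1) * nhsNormSq (-covLapSite W lam y)) :=
      Finset.sum_le_sum fun y _ => hsR_le_weighted _ _ one_pos
    simp only [hsR_neg_right, NE3CovariantCalculus.nhsNormSq_neg, Finset.sum_add_distrib, ← Finset.mul_sum, Finset.sum_neg_distrib] at hcs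
    rw [← hVdef, ← hD2def] at hcs
    linarith
  -- (3) `Gl = Σ hsR (Δλ)(λ) ≤ (t/2) D2 + (1/2t) Λ2` at `t = 4M²`, and Poincaré `Λ2 ≤ 4M² Gl`
  have hGeq : Gl = ∑ y ∈ periodBox (d := d) (N * L ^ (j + 1)), hsR (covLapSite W lam y) (lam y) := sum_nhsNormSq_gaugeDir_eq hP hWu hWP hlP
  have ht : (0 : ℝ) < 4 * M ^ 2 := by positivity
  have hcs2 : ∑ y ∈ periodBox (d := d) (N * L ^ (j + 1)), hsR (covLapSite W lam y) (lam y) ≤ ∑ y ∈ periodBox (d := d) (N * L ^ (j + 1)), ((4 * M ^ 2) / 2 * nhsNormSq (covLapSite W lam y) + 1 / (2 * (4 * M ^ 2)) * nhsNormSq (lam y)) :=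
    Finset.sum_le_sum fun y _ => hsR_le_weighted _ _ ht
  rw [Finset.sum_add_distrib, ← Finset.mul_sum, ← Finset.mul_sum, ← hD2def, ← hΛ2def, ← hGeq] at hcs2
  have hpoinc : Λ2 ≤ 4 * (M ^ 2 * Gl) := by
    have hξ : ∀ z ∈ periodBox (d := d) N, bmeanIterW L (j + 1) W lam z = 0 := fun z _ => by simp only [hl0, Pi.zero_apply]
    have h := sum_nhsNormSq_le_four_mul_of_bmeanIterW_eq_zero hL j hWu hx hs hWx N lam hξ hPs
    rw [Nat.mul_comm] at h
    rw [hΛ2def, hGdef, hMdef]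
    exact h
  -- (4) assemble: `Gl ≤ 2M²·D2 + Gl/2`
  have hfin : Gl ≤ 2 * M ^ 2 * D2 + Gl / 2 := by
    have h3 : 1 / (2 * (4 * M ^ 2)) * Λ2 ≤ Gl / 2 := by
      rw [show Gl / 2 = 1 / (2 * (4 * M ^ 2)) * (4 * (M ^ 2 * Gl)) by field_simp]
      exact mul_le_mul_of_nonneg_left hpoinc (by positivity)
    have h4 : (4 * M ^ 2) / 2 * D2 = 2 * M ^ 2 * D2 := by ring
    linarith
  have hM2 : 0 ≤ M ^ 2 := by positivity
  nlinarith [mul_le_mul_of_nonneg_left hD2V hM2]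

end

end Summit.QuantumFields.BalabanUV.T4Continuum.NE3.LandauProjectionB8
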